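import Mathlib

/-!
# Crux `PeriodicWindows` (stmt-AtomisticToContinuum-3240), line `Sketch`:
# stub E0b1b `stub_levelLattice`

Exact in-level rigidity (potential-free Euclidean geometry in `ℝ³`): in a `19/20`-separated set
`X ⊆ ℝ³` in which every point has a same-height point at distance `a ∈ [19/20, 1]` and every
same-height pair at distance `a` has BOTH equilateral completions in `X` (the hexagon-closure
property, a hypothesis here), every level `{q ∈ X | q 2 = p 2}` is the triangular lattice
`p + ℤu + ℤv` of spacing `a`.

Proof.  FRAME: `u = q₁ − p`, `v = r₁ − p` from one neighbour `q₁` and one completion `r₁` of the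
pair `(p, q₁)`, so `‖u‖ = ‖v‖ = ‖u − v‖ = a` and `⟪u, v⟫ = a²/2`.  DECOMPOSITION: a horizontal
vector is `αu + βv` (a `2 × 2` linear system in coordinates whose determinant squares to
`‖u‖²‖v‖² − ⟪u, v⟫² = 3a⁴/4`), and `‖αu + βv‖² = a²(α² + αβ + β²)`.  EDGE: the two completions
of a frame edge `(x, x + u)` are `x + v` and `x + u − v` (a quadratic system in `α, β`), so both
lie in `X`; run on the frames `(u, v)`, `(v, v − u)`, `(v − u, −u)`, `(−u, −v)` this puts all six
lattice neighbours of `x` in `X` as soon as one frame edge at `x` is in `X`.  PROPAGATION over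
`ℤ²` by induction.  ROUNDING: a same-height `q ∈ X` is `p + αu + βv`; the rounded lattice point
lies in `X` at squared distance `a²(α'² + α'β' + β'²) ≤ 3a²/4 ≤ 3/4 < (19/20)²` from `q`, hence
equals `q` by separation.  All `[folklore]`.
-/

noncomputable section

namespace Summit.AtomisticToContinuum.Crystallization.Theorems.PeriodicWindowsSketch

open RealInnerProductSpace

variable {a : ℝ}

/-! ## Frame algebra -/

/-- The squared norm of a combination `αu + βv` of a frame (`‖u‖ = ‖v‖ = a`, `⟪u, v⟫ = a²/2`)
is `a² (α² + αβ + β²)`. [folklore] -/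
theorem levelLattice_norm_sq_comb {u v : EuclideanSpace ℝ (Fin 3)} (hu : ‖u‖ = a) (hv : ‖v‖ = a)
    (huv : ⟪u, v⟫ = a ^ 2 / 2) (α β : ℝ) :
    ‖α • u + β • v‖ ^ 2 = a ^ 2 * (α ^ 2 + α * β + β ^ 2) := by
  have hvu : ⟪v, u⟫ = a ^ 2 / 2 := by rw [real_inner_comm]; exact huv
  rw [← real_inner_self_eq_norm_sq]
  simp only [inner_add_left, inner_add_right, real_inner_smul_left, real_inner_smul_right,
    huv, hvu]
  rw [real_inner_self_eq_norm_sq, real_inner_self_eq_norm_sq, hu, hv]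
  ring

/-- **Decomposition** of a horizontal vector along a horizontal frame: `d = αu + βv`
(coordinates; the determinant `u₀v₁ − u₁v₀` squares to `‖u‖²‖v‖² − ⟪u, v⟫² = 3a⁴/4 ≠ 0`).
[folklore] -/
theorem levelLattice_decomp (ha : 0 < a) {u v d : EuclideanSpace ℝ (Fin 3)} (hu2 : u 2 = 0)
    (hv2 : v 2 = 0) (hu : ‖u‖ = a) (hv : ‖v‖ = a) (huv : ⟪u, v⟫ = a ^ 2 / 2) (hd2 : d 2 = 0) :
    ∃ α β : ℝ, d = α • u + β • v := by
  have hi : ∀ x y : EuclideanSpace ℝ (Fin 3), ⟪x, y⟫ = x 0 * y 0 + x 1 * y 1 + x 2 * y 2 :=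
    fun x y => by simp [PiLp.inner_apply, Fin.sum_univ_three, mul_comm]
  have huu : u 0 * u 0 + u 1 * u 1 = a ^ 2 := by
    have h := real_inner_self_eq_norm_sq u
    rw [hi, hu, hu2] at h
    linarith
  have hvv : v 0 * v 0 + v 1 * v 1 = a ^ 2 := by
    have h := real_inner_self_eq_norm_sq v
    rw [hi, hv, hv2] at h
    linarith
  have huv' : u 0 * v 0 + u 1 * v 1 = a ^ 2 / 2 := by
    rw [hi, hu2, hv2] at huv
    linarith
  have hD : (u 0 * v 1 - u 1 * v 0) ^ 2 = 3 * a ^ 4 / 4 := by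
    have h : (u 0 * v 1 - u 1 * v 0) ^ 2 =
        (u 0 * u 0 + u 1 * u 1) * (v 0 * v 0 + v 1 * v 1) - (u 0 * v 0 + u 1 * v 1) ^ 2 := by ring
    rw [h, huu, hvv, huv']
    ring
  have hD0 : u 0 * v 1 - u 1 * v 0 ≠ 0 := by
    intro h0
    rw [h0] at hD
    have h4 : (0 : ℝ) < 3 * a ^ 4 / 4 := by positivity
    linarith
  refine ⟨(d 0 * v 1 - d 1 * v 0) / (u 0 * v 1 - u 1 * v 0),
    (u 0 * d 1 - u 1 * d 0) / (u 0 * v 1 - u 1 * v 0), ?_⟩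
  ext i
  fin_cases i
  · simp only [Fin.zero_eta, PiLp.add_apply, PiLp.smul_apply, smul_eq_mul]
    rw [div_mul_eq_mul_div, div_mul_eq_mul_div, ← add_div, eq_div_iff hD0]
    ring
  · simp only [Fin.mk_one, PiLp.add_apply, PiLp.smul_apply, smul_eq_mul]
    rw [div_mul_eq_mul_div, div_mul_eq_mul_div, ← add_div, eq_div_iff hD0]
    ring
  · simp only [Fin.reduceFinMk, PiLp.add_apply, PiLp.smul_apply, smul_eq_mul, hu2, hv2, hd2,
      mul_zero, add_zero]

/-- **The two equilateral completions of a frame edge**: a horizontal `d` with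
`‖d‖ = ‖d − u‖ = a` is `v` or `u − v`. [folklore] -/
theorem levelLattice_completion (ha : 0 < a) {u v d : EuclideanSpace ℝ (Fin 3)} (hu2 : u 2 = 0)
    (hv2 : v 2 = 0) (hu : ‖u‖ = a) (hv : ‖v‖ = a) (huv : ⟪u, v⟫ = a ^ 2 / 2) (hd2 : d 2 = 0)
    (hd : ‖d‖ = a) (hdu : ‖d - u‖ = a) : d = v ∨ d = u - v := by
  obtain ⟨α, β, rfl⟩ := levelLattice_decomp ha hu2 hv2 hu hv huv hd2
  have ha2 : a ^ 2 ≠ 0 := by positivity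
  have h1 : a ^ 2 * (α ^ 2 + α * β + β ^ 2) = a ^ 2 * 1 := by
    rw [← levelLattice_norm_sq_comb hu hv huv, hd, mul_one]
  have h2 : a ^ 2 * ((α - 1) ^ 2 + (α - 1) * β + β ^ 2) = a ^ 2 * 1 := by
    have e : (α - 1) • u + β • v = α • u + β • v - u := by module
    rw [← levelLattice_norm_sq_comb hu hv huv, e, hdu, mul_one]
  have e1 : α ^ 2 + α * β + β ^ 2 = 1 := mul_left_cancel₀ ha2 h1
  have e2 : (α - 1) ^ 2 + (α - 1) * β + β ^ 2 = 1 := mul_left_cancel₀ ha2 h2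
  have hβ : β = 1 - 2 * α := by linear_combination e1 - e2
  subst hβ
  have hα : α * (α - 1) = 0 := by linear_combination e1 / 3
  rcases mul_eq_zero.1 hα with h | h
  · left
    subst h
    module
  · right
    have h' : α = 1 := by linarith
    subst h'
    module

/-! ## Hexagon closure along a frame -/

/-- **One frame edge in `X` forces both of its equilateral completions into `X`**: if `x, x + u ∈ X`
then `x + v, x + (u − v) ∈ X` (the two distinct completions supplied by the hexagon-closure
hypothesis are classified by `levelLattice_completion`). [folklore] -/
theorem levelLattice_edge {X : Set (EuclideanSpace ℝ (Fin 3))} (ha : 0 < a)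
    (hhex : ∀ p ∈ X, ∀ q ∈ X, q 2 = p 2 → dist p q = a →
      ∃ r₁ ∈ X, ∃ r₂ ∈ X, r₁ ≠ r₂ ∧ r₁ 2 = p 2 ∧ r₂ 2 = p 2 ∧
        dist p r₁ = a ∧ dist q r₁ = a ∧ dist p r₂ = a ∧ dist q r₂ = a)
    {u v : EuclideanSpace ℝ (Fin 3)} (hu2 : u 2 = 0) (hv2 : v 2 = 0) (hu : ‖u‖ = a) (hv : ‖v‖ = a)
    (huv : ⟪u, v⟫ = a ^ 2 / 2) {x : EuclideanSpace ℝ (Fin 3)} (hx : x ∈ X) (hxu : x + u ∈ X) :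
    x + v ∈ X ∧ x + (u - v) ∈ X := by
  have h2 : (x + u) 2 = x 2 := by simp [hu2]
  have hd : dist x (x + u) = a := by rw [dist_eq_norm', add_sub_cancel_left, hu]
  obtain ⟨r₁, hr₁, r₂, hr₂, hne, hr₁2, hr₂2, hxr₁, hur₁, hxr₂, hur₂⟩ :=
    hhex x hx (x + u) hxu h2 hd
  have key : ∀ r : EuclideanSpace ℝ (Fin 3), r 2 = x 2 → dist x r = a → dist (x + u) r = a →
      r = x + v ∨ r = x + (u - v) := by
    intro r hr2 hxr hur
    have hd2 : (r - x) 2 = 0 := by simp [hr2]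
    have hdn : ‖r - x‖ = a := by rw [← dist_eq_norm']; exact hxr
    have hdu : ‖r - x - u‖ = a := by rw [sub_sub, ← dist_eq_norm']; exact hur
    rcases levelLattice_completion ha hu2 hv2 hu hv huv hd2 hdn hdu with h | h
    · left
      rw [← h]
      abel
    · right
      rw [← h]
      abel
  rcases key r₁ hr₁2 hxr₁ hur₁ with e₁ | e₁ <;> rcases key r₂ hr₂2 hxr₂ hur₂ with e₂ | e₂
  · exact absurd (e₁.trans e₂.symm) hne
  · exact ⟨by rw [← e₁]; exact hr₁, by rw [← e₂]; exact hr₂⟩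
  · exact ⟨by rw [← e₂]; exact hr₂, by rw [← e₁]; exact hr₁⟩
  · exact absurd (e₁.trans e₂.symm) hne

/-- **One frame edge in `X` forces all six lattice neighbours** `x + v, x + (u − v), x + (v − u),
x − u, x − v` (and `x + u`) into `X`: `levelLattice_edge` for the frames `(u, v)`, `(v, v − u)`,
`(v − u, −u)`, `(−u, −v)`. [folklore] -/
theorem levelLattice_six {X : Set (EuclideanSpace ℝ (Fin 3))} (ha : 0 < a)
    (hhex : ∀ p ∈ X, ∀ q ∈ X, q 2 = p 2 → dist p q = a →
      ∃ r₁ ∈ X, ∃ r₂ ∈ X, r₁ ≠ r₂ ∧ r₁ 2 = p 2 ∧ r₂ 2 = p 2 ∧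
        dist p r₁ = a ∧ dist q r₁ = a ∧ dist p r₂ = a ∧ dist q r₂ = a)
    {u v : EuclideanSpace ℝ (Fin 3)} (hu2 : u 2 = 0) (hv2 : v 2 = 0) (hu : ‖u‖ = a) (hv : ‖v‖ = a)
    (huv : ⟪u, v⟫ = a ^ 2 / 2) {x : EuclideanSpace ℝ (Fin 3)} (hx : x ∈ X) (hxu : x + u ∈ X) :
    x + v ∈ X ∧ x + (u - v) ∈ X ∧ x + (v - u) ∈ X ∧ x - u ∈ X ∧ x - v ∈ X := by
  have hvu : ⟪v, u⟫ = a ^ 2 / 2 := by rw [real_inner_comm]; exact huv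
  have hnvu : ‖v - u‖ = a := by
    have h : ‖v - u‖ ^ 2 = a ^ 2 := by rw [norm_sub_sq_real, hu, hv, hvu]; ring
    exact (sq_eq_sq₀ (norm_nonneg _) ha.le).1 h
  obtain ⟨h1, h2⟩ := levelLattice_edge ha hhex hu2 hv2 hu hv huv hx hxu
  -- frame `(v, v - u)`
  have f2a : (v - u) 2 = 0 := by simp [hu2, hv2]
  have f2i : ⟪v, v - u⟫ = a ^ 2 / 2 := by
    rw [inner_sub_right, real_inner_self_eq_norm_sq, hv, hvu]; ring
  obtain ⟨h3, -⟩ := levelLattice_edge ha hhex hv2 f2a hv hnvu f2i hx h1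
  -- frame `(v - u, -u)`
  have f3a : (-u) 2 = 0 := by simp [hu2]
  have f3n : ‖-u‖ = a := by rw [norm_neg, hu]
  have f3i : ⟪v - u, -u⟫ = a ^ 2 / 2 := by
    rw [inner_neg_right, inner_sub_left, real_inner_self_eq_norm_sq, hu, hvu]; ring
  obtain ⟨h4, -⟩ := levelLattice_edge ha hhex f2a f3a hnvu f3n f3i hx h3
  -- frame `(-u, -v)`
  have f4a : (-v) 2 = 0 := by simp [hv2]
  have f4n : ‖-v‖ = a := by rw [norm_neg, hv]
  have f4i : ⟪-u, -v⟫ = a ^ 2 / 2 := by rw [inner_neg_left, inner_neg_right, neg_neg, huv]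
  obtain ⟨h5, -⟩ := levelLattice_edge ha hhex f3a f4a f3n f4n f4i hx h4
  exact ⟨h1, h2, h3, by rw [sub_eq_add_neg]; exact h4, by rw [sub_eq_add_neg]; exact h5⟩

/-! ## Propagation over `ℤ²` -/

/-- **In-level propagation**: one frame edge `(p, p + u)` in `X` forces the whole triangular
lattice `p + ℤu + ℤv ⊆ X` (induction over `ℤ²`, `levelLattice_six` for the frames `(u, v)` and
`(−u, −v)` at every step). [folklore] -/
theorem levelLattice_lattice_subset {X : Set (EuclideanSpace ℝ (Fin 3))} (ha : 0 < a)
    (hhex : ∀ p ∈ X, ∀ q ∈ X, q 2 = p 2 → dist p q = a →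
      ∃ r₁ ∈ X, ∃ r₂ ∈ X, r₁ ≠ r₂ ∧ r₁ 2 = p 2 ∧ r₂ 2 = p 2 ∧
        dist p r₁ = a ∧ dist q r₁ = a ∧ dist p r₂ = a ∧ dist q r₂ = a)
    {u v : EuclideanSpace ℝ (Fin 3)} (hu2 : u 2 = 0) (hv2 : v 2 = 0) (hu : ‖u‖ = a) (hv : ‖v‖ = a)
    (huv : ⟪u, v⟫ = a ^ 2 / 2) {p : EuclideanSpace ℝ (Fin 3)} (hp : p ∈ X) (hpu : p + u ∈ X) :
    ∀ i j : ℤ, p + (i : ℝ) • u + (j : ℝ) • v ∈ X := by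
  have nu2 : (-u) 2 = 0 := by simp [hu2]
  have nv2 : (-v) 2 = 0 := by simp [hv2]
  have nu : ‖-u‖ = a := by rw [norm_neg, hu]
  have nv : ‖-v‖ = a := by rw [norm_neg, hv]
  have nuv : ⟪-u, -v⟫ = a ^ 2 / 2 := by rw [inner_neg_left, inner_neg_right, neg_neg, huv]
  have six : ∀ x ∈ X, x + u ∈ X →
      x + v ∈ X ∧ x + (u - v) ∈ X ∧ x + (v - u) ∈ X ∧ x - u ∈ X ∧ x - v ∈ X :=
    fun x hx hxu => levelLattice_six ha hhex hu2 hv2 hu hv huv hx hxu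
  have nsix : ∀ x ∈ X, x + -u ∈ X →
      x + -v ∈ X ∧ x + (-u - -v) ∈ X ∧ x + (-v - -u) ∈ X ∧ x - -u ∈ X ∧ x - -v ∈ X :=
    fun x hx hxu => levelLattice_six ha hhex nu2 nv2 nu nv nuv hx hxu
  let P : ℤ → ℤ → Prop := fun i j =>
    p + (i : ℝ) • u + (j : ℝ) • v ∈ X ∧ p + (i : ℝ) • u + (j : ℝ) • v + u ∈ X
  have h00 : P 0 0 := by
    have e0 : p + ((0 : ℤ) : ℝ) • u + ((0 : ℤ) : ℝ) • v = p := by push_cast; module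
    exact ⟨by rw [e0]; exact hp, by rw [e0]; exact hpu⟩
  have hsi : ∀ i j, P i j → P (i + 1) j := by
    rintro i j ⟨hq, hqu⟩
    have e1 : p + ((i + 1 : ℤ) : ℝ) • u + (j : ℝ) • v = p + (i : ℝ) • u + (j : ℝ) • v + u := by
      push_cast; module
    have hx' : p + (i : ℝ) • u + (j : ℝ) • v + u + -u ∈ X := by
      rw [← sub_eq_add_neg, add_sub_cancel_right]; exact hq
    obtain ⟨-, -, -, h4, -⟩ := nsix _ hqu hx'
    have hq' : p + ((i + 1 : ℤ) : ℝ) • u + (j : ℝ) • v ∈ X := by rw [e1]; exact hqu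
    have hqu' : p + ((i + 1 : ℤ) : ℝ) • u + (j : ℝ) • v + u ∈ X := by
      rw [e1, ← sub_neg_eq_add _ u]; exact h4
    exact ⟨hq', hqu'⟩
  have hpi : ∀ i j, P i j → P (i - 1) j := by
    rintro i j ⟨hq, hqu⟩
    obtain ⟨-, -, -, h4, -⟩ := six _ hq hqu
    have e1 : p + ((i - 1 : ℤ) : ℝ) • u + (j : ℝ) • v = p + (i : ℝ) • u + (j : ℝ) • v - u := by
      push_cast; module
    have hq' : p + ((i - 1 : ℤ) : ℝ) • u + (j : ℝ) • v ∈ X := by rw [e1]; exact h4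
    have hqu' : p + ((i - 1 : ℤ) : ℝ) • u + (j : ℝ) • v + u ∈ X := by
      rw [e1, sub_add_cancel]; exact hq
    exact ⟨hq', hqu'⟩
  have hsj : ∀ i j, P i j → P i (j + 1) := by
    rintro i j ⟨hq, hqu⟩
    obtain ⟨h1, -, -, -, -⟩ := six _ hq hqu
    have hx' : p + (i : ℝ) • u + (j : ℝ) • v + u + -u ∈ X := by
      rw [← sub_eq_add_neg, add_sub_cancel_right]; exact hq
    obtain ⟨-, -, -, -, h5⟩ := nsix _ hqu hx'
    have e1 : p + (i : ℝ) • u + ((j + 1 : ℤ) : ℝ) • v = p + (i : ℝ) • u + (j : ℝ) • v + v := by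
      push_cast; module
    have e2 : p + (i : ℝ) • u + (j : ℝ) • v + v + u = p + (i : ℝ) • u + (j : ℝ) • v + u - -v := by
      module
    have hq' : p + (i : ℝ) • u + ((j + 1 : ℤ) : ℝ) • v ∈ X := by rw [e1]; exact h1
    have hqu' : p + (i : ℝ) • u + ((j + 1 : ℤ) : ℝ) • v + u ∈ X := by rw [e1, e2]; exact h5
    exact ⟨hq', hqu'⟩
  have hpj : ∀ i j, P i j → P i (j - 1) := by
    rintro i j ⟨hq, hqu⟩
    obtain ⟨-, h2, -, -, h5⟩ := six _ hq hqu
    have e1 : p + (i : ℝ) • u + ((j - 1 : ℤ) : ℝ) • v = p + (i : ℝ) • u + (j : ℝ) • v - v := by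
      push_cast; module
    have e2 : p + (i : ℝ) • u + (j : ℝ) • v - v + u = p + (i : ℝ) • u + (j : ℝ) • v + (u - v) := by
      module
    have hq' : p + (i : ℝ) • u + ((j - 1 : ℤ) : ℝ) • v ∈ X := by rw [e1]; exact h5
    have hqu' : p + (i : ℝ) • u + ((j - 1 : ℤ) : ℝ) • v + u ∈ X := by rw [e1, e2]; exact h2
    exact ⟨hq', hqu'⟩
  have hi0 : ∀ i, P i 0 := fun i =>
    Int.induction_on i h00 (fun i ih => hsi _ _ ih) (fun i ih => hpi _ _ ih)
  exact fun i j =>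
    (Int.induction_on j (hi0 i) (fun j ih => hsj _ _ ih) (fun j ih => hpj _ _ ih) : P i j).1

/-! ## Rounding and separation -/

/-- **Rounding**: if the lattice `p + ℤu + ℤv` lies in the `19/20`-separated set `X`, then every
same-height point `q ∈ X` is a lattice point (it lies within squared distance `3a²/4 < (19/20)²` of
the rounded lattice point). [folklore] -/
theorem levelLattice_mem_lattice {X : Set (EuclideanSpace ℝ (Fin 3))} (ha1 : 19 / 20 ≤ a)
    (ha2 : a ≤ 1)
    (hsep : ∀ p ∈ X, ∀ q ∈ X, p ≠ q → 19 / 20 ≤ dist p q)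
    {u v : EuclideanSpace ℝ (Fin 3)} (hu2 : u 2 = 0) (hv2 : v 2 = 0) (hu : ‖u‖ = a) (hv : ‖v‖ = a)
    (huv : ⟪u, v⟫ = a ^ 2 / 2) {p q : EuclideanSpace ℝ (Fin 3)}
    (hlat : ∀ i j : ℤ, p + (i : ℝ) • u + (j : ℝ) • v ∈ X)
    (hq : q ∈ X) (hq2 : q 2 = p 2) : ∃ i j : ℤ, q = p + (i : ℝ) • u + (j : ℝ) • v := by
  have ha : 0 < a := by linarith
  have hd2 : (q - p) 2 = 0 := by simp [hq2]
  obtain ⟨α, β, hαβ⟩ := levelLattice_decomp ha hu2 hv2 hu hv huv hd2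
  refine ⟨round α, round β, ?_⟩
  by_contra hne
  have hLX : p + ((round α : ℤ) : ℝ) • u + ((round β : ℤ) : ℝ) • v ∈ X := hlat _ _
  have hfar : 19 / 20 ≤ dist q (p + ((round α : ℤ) : ℝ) • u + ((round β : ℤ) : ℝ) • v) :=
    hsep q hq _ hLX hne
  have hq' : q = α • u + β • v + p := sub_eq_iff_eq_add.1 hαβ
  have hdiff : q - (p + ((round α : ℤ) : ℝ) • u + ((round β : ℤ) : ℝ) • v) =
      (α - round α) • u + (β - round β) • v := by
    rw [hq']; module
  have hdist : dist q (p + ((round α : ℤ) : ℝ) • u + ((round β : ℤ) : ℝ) • v) ^ 2 =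
      a ^ 2 * ((α - round α) ^ 2 + (α - round α) * (β - round β) + (β - round β) ^ 2) := by
    rw [dist_eq_norm, hdiff, levelLattice_norm_sq_comb hu hv huv]
  obtain ⟨hα1, hα2⟩ := abs_le.1 (abs_sub_round α)
  obtain ⟨hβ1, hβ2⟩ := abs_le.1 (abs_sub_round β)
  have hsum : (α - round α) ^ 2 + (α - round α) * (β - round β) + (β - round β) ^ 2 ≤ 3 / 4 := by
    nlinarith [mul_nonneg (sub_nonneg.2 hα2) (neg_le_iff_add_nonneg'.1 hα1),
      mul_nonneg (sub_nonneg.2 hβ2) (neg_le_iff_add_nonneg'.1 hβ1),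
      mul_nonneg (sub_nonneg.2 hα2) (neg_le_iff_add_nonneg'.1 hβ1),
      mul_nonneg (sub_nonneg.2 hβ2) (neg_le_iff_add_nonneg'.1 hα1)]
  have hle : dist q (p + ((round α : ℤ) : ℝ) • u + ((round β : ℤ) : ℝ) • v) ^ 2 ≤ 3 / 4 := by
    rw [hdist]
    have hsq : a ^ 2 ≤ 1 := by nlinarith
    have hnn : 0 ≤ (α - round α) ^ 2 + (α - round α) * (β - round β) + (β - round β) ^ 2 := by
      nlinarith [sq_nonneg (α - round α + (β - round β)), sq_nonneg (α - round α),
        sq_nonneg (β - round β)]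
    nlinarith
  have hge : (19 / 20 : ℝ) ^ 2 ≤
      dist q (p + ((round α : ℤ) : ℝ) • u + ((round β : ℤ) : ℝ) • v) ^ 2 :=
    pow_le_pow_left₀ (by norm_num) hfar 2
  linarith

/-! ## The stub -/

/-- STUB E0b1b (exact in-level rigidity): in a `19/20`-separated `X ⊆ ℝ³` with six same-height
points at distance `a ∈ [19/20, 1]` around every point and the hexagon-closure property (both
equilateral completions of a same-height pair at distance `a` lie in `X`), every level
`{q ∈ X | q 2 = p 2}` is a triangular lattice `p + ℤu + ℤv` of spacing `a` (frame from one
neighbour and one completion; propagation over `ℤ²`; rounding + separation). [folklore] -/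
theorem stub_levelLattice (X : Set (EuclideanSpace ℝ (Fin 3))) (a : ℝ) (ha1 : 19 / 20 ≤ a)
    (ha2 : a ≤ 1)
    (hsep : ∀ p ∈ X, ∀ q ∈ X, p ≠ q → 19 / 20 ≤ dist p q)
    (hsix : ∀ p ∈ X, ∃ F : Finset (EuclideanSpace ℝ (Fin 3)), F.card = 6 ∧
      ∀ q ∈ F, q ∈ X ∧ q 2 = p 2 ∧ dist p q = a)
    (hhex : ∀ p ∈ X, ∀ q ∈ X, q 2 = p 2 → dist p q = a →
      ∃ r₁ ∈ X, ∃ r₂ ∈ X, r₁ ≠ r₂ ∧ r₁ 2 = p 2 ∧ r₂ 2 = p 2 ∧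
        dist p r₁ = a ∧ dist q r₁ = a ∧ dist p r₂ = a ∧ dist q r₂ = a) :
    ∀ p ∈ X, ∃ u v : EuclideanSpace ℝ (Fin 3), u 2 = 0 ∧ v 2 = 0 ∧ ‖u‖ = a ∧ ‖v‖ = a ∧
      inner ℝ u v = a ^ 2 / 2 ∧
      {q ∈ X | q 2 = p 2} = {q | ∃ i j : ℤ, q = p + (i : ℝ) • u + (j : ℝ) • v} := by
  intro p hp
  have ha : 0 < a := by linarith
  obtain ⟨F, hF, hFX⟩ := hsix p hp
  obtain ⟨q₁, hq₁⟩ : F.Nonempty := by rw [← Finset.card_pos, hF]; norm_num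
  obtain ⟨hq₁X, hq₁2, hq₁d⟩ := hFX q₁ hq₁
  obtain ⟨r₁, hr₁X, -, -, -, hr₁2, -, hpr₁, hqr₁, -, -⟩ := hhex p hp q₁ hq₁X hq₁2 hq₁d
  have hu2 : (q₁ - p) 2 = 0 := by simp [hq₁2]
  have hv2 : (r₁ - p) 2 = 0 := by simp [hr₁2]
  have hu : ‖q₁ - p‖ = a := by rw [← dist_eq_norm']; exact hq₁d
  have hv : ‖r₁ - p‖ = a := by rw [← dist_eq_norm']; exact hpr₁
  have huv : ⟪q₁ - p, r₁ - p⟫ = a ^ 2 / 2 := by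
    have h1 : ‖(q₁ - p) - (r₁ - p)‖ = a := by
      rw [sub_sub_sub_cancel_right, ← dist_eq_norm]; exact hqr₁
    have h2 := norm_sub_sq_real (q₁ - p) (r₁ - p)
    rw [h1, hu, hv] at h2
    linarith
  have hpu : p + (q₁ - p) ∈ X := by rw [add_sub_cancel]; exact hq₁X
  have hlat := levelLattice_lattice_subset ha hhex hu2 hv2 hu hv huv hp hpu
  refine ⟨q₁ - p, r₁ - p, hu2, hv2, hu, hv, huv, ?_⟩
  ext q
  simp only [Set.mem_setOf_eq]
  constructor
  · rintro ⟨hqX, hq2⟩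
    exact levelLattice_mem_lattice ha1 ha2 hsep hu2 hv2 hu hv huv hlat hqX hq2
  · rintro ⟨i, j, rfl⟩
    exact ⟨hlat i j, by simp [hq₁2, hr₁2]⟩

end Summit.AtomisticToContinuum.Crystallization.Theorems.PeriodicWindowsSketch

end
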